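import Literature.MathematicalPhysics.QuantumFieldTheory.Balaban1983to89.Node00.Record12BgRowCoDiv

/-!
# NODE 00 — ROW P11, RIDER TO FILE 9: THE DICTIONARY `Sect2.coDivSum` ↔ `B10Eq68TorusRegularity.covDivT`, `Sect2.CoDivSmallOn` ↔ `RegDivAt`,
# `Sect2.CoDivClassOn` ↔ the (1.9)-half of `InSpaceA`∕`InSpace` (dag-lead DEDUP READY-9 «one bridge owed»)

Cell `pub-ymgap`, seat `pub-ymgap-node00-def-P11` g2 (R218).  dag-lead DEDUP READY-9 (INBOX l.17462): «`Sect2.coDivSum U x μ` (η-free, `M_N(ℂ)` via `ιSU`) is the record-currency twin of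
the tree's `B10Eq68TorusRegularity.covDivT η (unitsField (toUField U)) μ x` (= [6] (1.2) on the torus WITH BODY, used at the record in `Node00.CriticalOfRecord` and behind
`Node00.BackgroundCurrentShape.UkInSpaceB11`) — please land the identification and hence `CoDivClassOn Ω k ε U ↔ ∀ j ≤ k, RegDivAt j (…Ω j…) ε η_j (unitsField (toUField U))` up to the
`omegaBonds`∕`BTouches` reading at `j = 0`, so the K1-lane producers keyed on `InSpace`∕`RegDivAt` convert to the `h9` guard BY NAME.»

HONEST FRAMING.  Pure bookkeeping between two typings already in the tree — no content of Bałaban; nothing asserted or discharged; K0⁗ NOT closed; counts unmoved; finite `𝕋⁴`;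
not continuum ∕ OS ∕ mass gap ∕ Clay.  Every identity is `rfl`∕`unfold`+`rw` on r11's `ιSU`, [B10]'s `unitsField ∘ toUField`, `holT_plaqWord_eq_plaqHol`, `covDivT_eq_smul`,
`regDivAt_iff_unit`.  No `def`, no `instance`, no `sorry`.

WHAT IS PROVED (all `η > 0` where a spacing enters; the spacing CANCELS against print's threshold `εL^{−2j}(L^jη)^{−1}`, [B10] `regDivAt_iff_unit`):
* `Sect2.unitsField_toUField_apply` (`unitsField (toUField U) b = ιSU N (U b)`, `rfl`), `Sect2.plaqFT_unitsField_toUField_eq_plaqMat`, `Sect2.covDerivT_one_plaqFT_eq_coDivTerm`;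
* ★ `Sect2.covDivT_one_unitsField_toUField : covDivT 1 (unitsField (toUField U)) μ x = Sect2.coDivSum U x μ` and `Sect2.norm_covDivT_unitsField_toUField :
  ‖covDivT η (unitsField (toUField U)) μ x‖ = η⁻¹ * ‖Sect2.coDivSum U x μ‖`;
* ★ `Sect2.coDivSmallOn_bondsOf_iff_regDivAt : Sect2.CoDivSmallOn (bondsOf X) (ε * P.eta j ^ 3) U ↔ RegDivAt j X ε η (unitsField (toUField U))` (`bondsOf X` = `BTouches X`, `Iff.rfl`;
  `(L^j)⁻³ = η_j³`);
* ★★ `Sect2.coDivClassOn_iff_regDivAt : Sect2.CoDivClassOn Ω k ε U ↔ ∀ j ≤ k, RegDivAt j (if j = 0 then univ else Ω j) ε η (unitsField (toUField U))` (the record's sequences have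
  `Ω 0 = ∅` by `Seq.Ω_off`; print's `Ω_0 = T` is the `j = 0` branch of `Sect2.omegaBonds`), with the two directions `Sect2.coDivClassOn_of_regDivAt` (regions `Ω′_j ⊇ …`, `Ω′_0 = T`)
  and `Sect2.CoDivClassOn.regDivAt`, and ★ `Sect2.coDivClassOn_of_inSpace_univ : InSpace k (fun _ => univ) ε η (toUField U) → Sect2.CoDivClassOn Ω k ε U` (n01-b's
  `InUkClassB11 F N K k ε U` unfolds to the hypothesis with `η = η_k`).

(v1.1) §2 `VariationalThm1RegSepPrintedCo.of_le`, `VariationalThm1RegSepPrinted.of_le`: the [15] facts as typed are ANTITONE in `a₀`, `a₁` (director-ym №145 (ii)∕№146 — `a₀` inside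
[4] Prop. 2's range costs row P11 nothing; node00-def-R ANSWER-145(ii) joint).

DEPENDENCES (by name): FILE 9 `Sect2.(plaqMat, coDivTerm, coDivSum, CoDivSmallOn, omegaBonds, CoDivClassOn)`; r11 `ιSU`; [B10] `B10Eq27TorusAxialLog.(holT, unitsField, toUField, suIncl,
val_holT_unitsField, holT_toUField, val_suIncl, holT_plaqWord_eq_plaqHol)`, `B10Eq68TorusRegularity.(plaqFT, covDerivT, covDivT, RegDivAt, BTouches, InSpace, covDivT_eq_smul,
regDivAt_iff_unit, RegDivAt.of_subset, InSpace.regDivAt)`; `B7Eq78Linearization.conjR_apply`; r12 `B15DeterminingSets.bondsOf`; `Params.eta`.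
-/

noncomputable section

open scoped Matrix.Norms.L2Operator

namespace Literature.MathematicalPhysics.QuantumFieldTheory.Balaban1983to89.Node00

open T4Continuum B14.Eq218Concrete B15DeterminingSets B12RegularSpaces111 B14RegularSpaces234 B14Radii T4AxialGaugeSmallField

/-! ## §1  THE DICTIONARY WITH THE TREE'S TORUS (1.2)∕(1.9): `Sect2.coDivSum` IS `B10Eq68TorusRegularity.covDivT 1` READ THROUGH `SU(N) ≤ U(N) ≤ M_N(ℂ)ˣ`,
`Sect2.CoDivSmallOn (bondsOf X) (ε·η_j³)` IS `RegDivAt j X ε η`, `Sect2.CoDivClassOn` IS the (1.9)-half of `InSpaceA` (dag-lead DEDUP READY-9 bridge) -/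

section Bridge

open B7Prop1Explicit (plaqWord)
open B7Eq78Linearization (conjR conjR_apply)
open B10Eq27TorusAxialLog (holT toUField unitsField suIncl val_suIncl val_holT_unitsField holT_toUField holT_plaqWord_eq_plaqHol)
open B10Eq68TorusRegularity (plaqFT covDerivT covDivT RegDivAt BTouches InSpace InSpaceA covDivT_eq_smul regDivAt_iff_unit)

variable {P : Params} {j : ℕ} {N : ℕ} [NeZero N]

omit [NeZero N] in
/-- **DICTIONARY, bond units**: the `M_N(ℂ)ˣ`-reading of an `SU(N)` configuration through `U(N)` (`unitsField ∘ toUField`, [B10]) IS r11's embedding `ιSU` bond by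
bond (`rfl`: both are `Unitary.toUnits` after the inclusion `SU(N) ≤ U(N)`). [cite: Balaban1985Averaging, (19) p.21 (the U(N) model, bookkeeping)] -/
theorem Sect2.unitsField_toUField_apply (U : GaugeField P j (SU N)) (b : PBond P j) : unitsField (toUField U) b = ιSU N (U b) := rfl

/-- **DICTIONARY, plaquette fields**: [B10]'s torus plaquette field `F_{μν}(x) = V(∂p_{μν}(x))` of the `M_N(ℂ)ˣ`-reading, `μ < ν`, IS the embedded plaquette variable
`Sect2.plaqMat U x μ ν` (`holT` along the plaquette word = `GaugeField.plaqHol`). [cite: Balaban1985RegularSpaces, (1.2) p.76; Balaban1985Averaging, (9) p.19] -/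
theorem Sect2.plaqFT_unitsField_toUField_eq_plaqMat (U : GaugeField P j (SU N)) (x : Site P j) {μ ν : Fin P.d} (h : μ < ν) :
    plaqFT (unitsField (toUField U)) μ ν x = Sect2.plaqMat U x μ ν h := by
  unfold plaqFT Sect2.plaqMat
  rw [val_holT_unitsField, holT_toUField, val_suIncl, holT_plaqWord_eq_plaqHol U ⟨x, μ, ν, h⟩]
  rfl

/-- **DICTIONARY, (1.1) one term**: at unit spacing, [B10]'s backward covariant derivative of the plaquette field `F_{αβ}` in direction `ν` IS `Sect2.coDivTerm U x ν α β`
(`R(V(x, x−e_ν))X = V⟨x−e_ν,ν⟩⁻¹·X·V⟨x−e_ν,ν⟩`). [cite: Balaban1985RegularSpaces, (1.1) p.76] -/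
theorem Sect2.covDerivT_one_plaqFT_eq_coDivTerm (U : GaugeField P j (SU N)) (x : Site P j) (ν : Fin P.d) {α β : Fin P.d} (h : α < β) :
    covDerivT 1 (unitsField (toUField U)) ν (plaqFT (unitsField (toUField U)) α β) x = Sect2.coDivTerm U x ν α β h := by
  unfold covDerivT Sect2.coDivTerm
  rw [inv_one, one_smul, conjR_apply, inv_inv, Sect2.plaqFT_unitsField_toUField_eq_plaqMat U _ h,
    Sect2.plaqFT_unitsField_toUField_eq_plaqMat U _ h]
  rfl

/-- **DICTIONARY, (1.2) = `Sect2.coDivSum` AT UNIT SPACING**: `(D^{1*}_V ∂V)_μ(x)` of the `M_N(ℂ)ˣ`-reading `V = unitsField (toUField U)` IS `Sect2.coDivSum U x μ`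
(`Σ_{ν<μ} − Σ_{ν>μ}` = the signed `dite`-sum over all `ν`). [cite: Balaban1985RegularSpaces, (1.2) p.76] -/
theorem Sect2.covDivT_one_unitsField_toUField (U : GaugeField P j (SU N)) (μ : Fin P.d) (x : Site P j) :
    covDivT 1 (unitsField (toUField U)) μ x = Sect2.coDivSum U x μ := by
  have hsplit : ∀ ν : Fin P.d,
      (if h : ν < μ then Sect2.coDivTerm U x ν ν μ h else if h' : μ < ν then -Sect2.coDivTerm U x ν μ ν h' else 0) =
        (if h : ν < μ then Sect2.coDivTerm U x ν ν μ h else 0) - (if h' : μ < ν then Sect2.coDivTerm U x ν μ ν h' else 0) := by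
    intro ν
    by_cases h : ν < μ
    · rw [dif_pos h, dif_pos h, dif_neg (lt_asymm h), sub_zero]
    · rw [dif_neg h, dif_neg h, zero_sub]
      by_cases h' : μ < ν
      · rw [dif_pos h', dif_pos h']
      · rw [dif_neg h', dif_neg h', neg_zero]
  have hA : ∑ ν ∈ Finset.Iio μ, covDerivT 1 (unitsField (toUField U)) ν (plaqFT (unitsField (toUField U)) ν μ) x =
      ∑ ν, (if h : ν < μ then Sect2.coDivTerm U x ν ν μ h else 0) := by
    rw [← Finset.sum_subset (Finset.subset_univ (Finset.Iio μ))
      (fun ν _ hν => by rw [dif_neg (fun h => hν (Finset.mem_Iio.mpr h))])]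
    exact Finset.sum_congr rfl fun ν hν => by
      rw [dif_pos (Finset.mem_Iio.mp hν), Sect2.covDerivT_one_plaqFT_eq_coDivTerm]
  have hB : ∑ ν ∈ Finset.Ioi μ, covDerivT 1 (unitsField (toUField U)) ν (plaqFT (unitsField (toUField U)) μ ν) x =
      ∑ ν, (if h' : μ < ν then Sect2.coDivTerm U x ν μ ν h' else 0) := by
    rw [← Finset.sum_subset (Finset.subset_univ (Finset.Ioi μ))
      (fun ν _ hν => by rw [dif_neg (fun h => hν (Finset.mem_Ioi.mpr h))])]
    exact Finset.sum_congr rfl fun ν hν => by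
      rw [dif_pos (Finset.mem_Ioi.mp hν), Sect2.covDerivT_one_plaqFT_eq_coDivTerm]
  unfold covDivT Sect2.coDivSum
  rw [hA, hB, ← Finset.sum_sub_distrib]
  exact Finset.sum_congr rfl fun ν _ => (hsplit ν).symm

/-- **DICTIONARY, (1.2) AT SPACING `η`, NORMS**: `‖(D^{η*}_V ∂V)_μ(x)‖ = η⁻¹·‖Sect2.coDivSum U x μ‖` for `η > 0` (`D^{η*} = η⁻¹D^{1*}`, `covDivT_eq_smul`).
[cite: Balaban1985RegularSpaces, (1.1)–(1.2) p.76] -/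
theorem Sect2.norm_covDivT_unitsField_toUField {η : ℝ} (hη : 0 < η) (U : GaugeField P j (SU N)) (μ : Fin P.d) (x : Site P j) :
    ‖covDivT η (unitsField (toUField U)) μ x‖ = η⁻¹ * ‖Sect2.coDivSum U x μ‖ := by
  rw [covDivT_eq_smul η, norm_smul, Real.norm_eq_abs, abs_of_pos (inv_pos.mpr hη), Sect2.covDivT_one_unitsField_toUField]

/-- The threshold letters agree: `(L^j)⁻³ = η_j³` (`Params.eta j = (L⁻¹)^j`). [cite: Balaban1987RG1, (1.2) p.260 (bookkeeping)] -/
theorem Sect2.inv_pow_cube_eq_eta_cube (P : Params) (j : ℕ) : (((P.L : ℝ) ^ j)⁻¹) ^ 3 = P.eta j ^ 3 := by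
  rw [Params.eta, ← inv_pow]

/-- «b ∈ Ω» ([6] p. 77: at least one end-point in `Ω`): r12's `bondsOf X` IS [B10]'s `BTouches X` (`Iff.rfl`). [cite: Balaban1985RegularSpaces, p.77 (convention before (1.5))] -/
theorem Sect2.mem_bondsOf_iff_bTouches {s : ℕ} (X : Set (Site P s)) (b : PBond P s) : b ∈ bondsOf X ↔ BTouches X b := Iff.rfl

/-- **★ (1.9) ON THE BONDS MEETING `X` AT SCALE `j`: `Sect2.CoDivSmallOn (bondsOf X) (ε·η_j³) U ↔ RegDivAt j X ε η (unitsField (toUField U))`** for any spacing `η > 0`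
(the spacing cancels against print's threshold `εL^{−2j}(L^jη)^{−1}`: `regDivAt_iff_unit`). [cite: Balaban1985RegularSpaces, (1.9) p.77; Balaban1985Variational, (2) p.278] -/
theorem Sect2.coDivSmallOn_bondsOf_iff_regDivAt {X : Set (Site P 0)} {ε η : ℝ} (hη : 0 < η) (U : GaugeField P 0 (SU N)) (j : ℕ) :
    Sect2.CoDivSmallOn (bondsOf X) (ε * P.eta j ^ 3) U ↔ RegDivAt j X ε η (unitsField (toUField U)) := by
  rw [regDivAt_iff_unit hη]
  refine forall_congr' fun b => ?_
  rw [Sect2.covDivT_one_unitsField_toUField, Sect2.inv_pow_cube_eq_eta_cube]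
  rfl

/-- `Sect2.omegaBonds Ω j` is `bondsOf` of the region «all of `T` at `j = 0`, `Ω_j` for `j ≥ 1`» (the record's sequences have `Ω 0 = ∅` by `Seq.Ω_off`, print's `Ω_0 = T`).
[cite: Balaban1985RegularSpaces, (1.9) p.77 («j = 0, 1, …, k»); Balaban1988Convergent, (2.4) p.255] -/
theorem Sect2.omegaBonds_eq_bondsOf (Ω : ℕ → Set (Site P 0)) (j : ℕ) :
    Sect2.omegaBonds Ω j = bondsOf (if j = 0 then Set.univ else Ω j) := by
  unfold Sect2.omegaBonds
  split_ifs with hj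
  · ext b
    exact ⟨fun _ => Or.inl (Set.mem_univ _), fun _ => Set.mem_univ _⟩
  · rfl

/-- **★★ THE (1.9)-HALF OF `U_k({Ω_j}, ε)` IN THE TWO CURRENCIES: `Sect2.CoDivClassOn Ω k ε U ↔ ∀ j ≤ k, RegDivAt j (T if j = 0, else Ω_j) ε η (unitsField (toUField U))`**, any `η > 0` —
so producers keyed on [B10]'s `RegDivAt`∕`InSpaceA`∕`InSpace` ([B8] Prop. 7 readers, n01-b's `InUkClassB11` homes) feed the v1.3 guard `h9` BY NAME. [cite: Balaban1985RegularSpaces, (1.9) p.77;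
Balaban1985Variational, (2) p.278] -/
theorem Sect2.coDivClassOn_iff_regDivAt {Ω : ℕ → Set (Site P 0)} {k : ℕ} {ε η : ℝ} (hη : 0 < η) (U : GaugeField P 0 (SU N)) :
    Sect2.CoDivClassOn Ω k ε U ↔ ∀ j, j ≤ k → RegDivAt j (if j = 0 then Set.univ else Ω j) ε η (unitsField (toUField U)) := by
  refine forall₂_congr fun j _ => ?_
  rw [Sect2.omegaBonds_eq_bondsOf, Sect2.coDivSmallOn_bondsOf_iff_regDivAt hη]

/-- From the class in [B10]'s letters on regions `Ω′_j ⊇ (T if j = 0, else Ω_j)` to the guard `h9`. [cite: Balaban1985Variational, (2) p.278; Balaban1985RegularSpaces, (1.9) p.77] -/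
theorem Sect2.coDivClassOn_of_regDivAt {Ω Ω' : ℕ → Set (Site P 0)} {k : ℕ} {ε η : ℝ} (hη : 0 < η) {U : GaugeField P 0 (SU N)}
    (hΩ0 : Ω' 0 = Set.univ) (hΩ : ∀ j, 1 ≤ j → j ≤ k → Ω j ⊆ Ω' j)
    (h : ∀ j, j ≤ k → RegDivAt j (Ω' j) ε η (unitsField (toUField U))) : Sect2.CoDivClassOn Ω k ε U := by
  refine (Sect2.coDivClassOn_iff_regDivAt hη U).mpr fun j hj => (h j hj).of_subset ?_
  split_ifs with hj0
  · rw [hj0, hΩ0]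
  · exact hΩ j (Nat.one_le_iff_ne_zero.mpr hj0) hj

/-- **From `V ∈ U_k({T}, ε)` in [B10]'s full-space letters (`InSpace k (fun _ => T) ε η (toUField U))`, e.g. n01-b's `InUkClassB11 F N K k ε U`, η = η_k) to the guard `h9` for ANY
domain sequence** (regions only shrink the bond set). [cite: Balaban1985Variational, (2) p.278; Balaban1985RegularSpaces, (1.9) p.77] -/
theorem Sect2.coDivClassOn_of_inSpace_univ {Ω : ℕ → Set (Site P 0)} {k : ℕ} {ε η : ℝ} (hη : 0 < η) {U : GaugeField P 0 (SU N)}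
    (h : InSpace k (fun _ => (Set.univ : Set (Site P 0))) ε η (toUField U)) : Sect2.CoDivClassOn Ω k ε U :=
  Sect2.coDivClassOn_of_regDivAt (Ω' := fun _ => Set.univ) hη rfl (fun _ _ _ => Set.subset_univ _) fun _ hj => h.regDivAt hj

/-- Conversely, the guard `h9` gives [B10]'s divergence clauses on the record's regions (`T` at `j = 0`). [cite: Balaban1985Variational, (2) p.278; Balaban1985RegularSpaces, (1.9) p.77] -/
theorem Sect2.CoDivClassOn.regDivAt {Ω : ℕ → Set (Site P 0)} {k : ℕ} {ε η : ℝ} (hη : 0 < η) {U : GaugeField P 0 (SU N)}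
    (h : Sect2.CoDivClassOn Ω k ε U) {j : ℕ} (hj : j ≤ k) : RegDivAt j (if j = 0 then Set.univ else Ω j) ε η (unitsField (toUField U)) :=
  (Sect2.coDivClassOn_iff_regDivAt hη U).mp h j hj

end Bridge

/-! ## §2  (v1.1) [15] THM 1 AS TYPED IS ANTITONE IN ITS RANGE LETTERS `a₀`, `a₁` (director-ym №145 (ii) ∕ №146: `a₀` may be taken inside [4] Prop. 2's range with row P11's letters unchanged) -/

section Antitone

variable {F : T4Family} {N : ℕ} [NeZero N]

/-- **`VariationalThm1RegSepPrintedCo` IS ANTITONE IN `a₀` AND `a₁`.**  Print ([15] Thm 1 p.279): «There exist positive constants a₀, a₁, B₃ … B₃a₁ ≤ a₀ such that … if B₃ε₁ ≤ ε₀ and ε₀ ≤ a₀ …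
The constants a₀, a₁, B₃ depend on d and L only» — `a₀`, `a₁` enter the typed fact ONLY as the ceilings `ε₀ ≤ a₀`, `δ_n ≤ a₁`, so the fact at `(a₀, a₁)` gives the fact at every `a₀′ ≤ a₀`, `a₁′ ≤ a₁`;
in particular `a₀` may be taken inside [4] Prop. 2's range (`a₀′ := min a₀ c₂`) WITHOUT touching row P11's letters — the price is paid by the run (`ha₀ : ν.εreg ≤ a₀′`, `hnum : B₃·cR·ε_n ≤ ν.εreg`), i.e.
print's standing «g₀ sufficiently small» (node00-def-R ANSWER-145(ii), joint). [cite: Balaban1985Variational, Thm 1 p.279 (the range «ε₀ ≤ a₀», «ε₁ ≤ a₁»); Balaban1985Averaging, Prop. 2 (52)–(54) p.26] -/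
theorem VariationalThm1RegSepPrintedCo.of_le {B₃ a₀ a₀' a₁ a₁' : ℝ} (h : VariationalThm1RegSepPrintedCo F N B₃ a₀ a₁) (ha₀ : a₀' ≤ a₀) (ha₁ : a₁' ≤ a₁) :
    VariationalThm1RegSepPrintedCo F N B₃ a₀' a₁' :=
  fun ν M g K k s hsep ε₀ δ hnum hcomp hε W h7 U₀ hmin h9 =>
    h ν M g K k s hsep ε₀ δ (fun n hn => ⟨(hnum n hn).1, (hnum n hn).2.1.trans ha₁, (hnum n hn).2.2⟩) hcomp (hε.trans ha₀) W h7 U₀ hmin h9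

/-- The same for the (1.7)-only fact `VariationalThm1RegSepPrinted` (FILE 8 v1.3). [cite: Balaban1985Variational, Thm 1 p.279 (the range «ε₀ ≤ a₀», «ε₁ ≤ a₁»)] -/
theorem VariationalThm1RegSepPrinted.of_le {B₃ a₀ a₀' a₁ a₁' : ℝ} (h : VariationalThm1RegSepPrinted F N B₃ a₀ a₁) (ha₀ : a₀' ≤ a₀) (ha₁ : a₁' ≤ a₁) :
    VariationalThm1RegSepPrinted F N B₃ a₀' a₁' :=
  fun ν M g K k s hsep ε₀ δ hnum hcomp hε W h7 U₀ hmin =>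
    h ν M g K k s hsep ε₀ δ (fun n hn => ⟨(hnum n hn).1, (hnum n hn).2.1.trans ha₁, (hnum n hn).2.2⟩) hcomp (hε.trans ha₀) W h7 U₀ hmin

end Antitone

end Literature.MathematicalPhysics.QuantumFieldTheory.Balaban1983to89.Node00

end
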